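import Mathlib
import Literature.Geometry.Lorentzian.GiorgiKlainermanSzeftel2022.GRWTransformationAlgebra

/-!
# Giorgi–Klainerman–Szeftel, *Wave equations estimates and the nonlinear stability of slowly rotating Kerr black holes* — App. D.10 ledger: the relation between `𝔮̲` and `P̌` (proof of Proposition 5.6.1)

Sources, read side by side (the loci of both are given in every docstring):

* `[J]`  E. Giorgi, S. Klainerman, J. Szeftel, *Wave equations estimates and the nonlinear
  stability of slowly rotating Kerr black holes*, Pure Appl. Math. Q. **20** (2024), no. 7
  (doi:10.4310/pamq.241128023033) — Proposition 5.6.1 with (5.6.1), (5.6.2) (file p0208 L11–52: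
  "The following identity will be used in Chapter 14 …") and Appendix D.10 "Proof of Proposition
  5.6.1" (p0931 L72 – p0935 L35); the quoted inputs Proposition 2.4.15 (Bianchi identities in
  complex notation, p0118 L33–100: the rows `ᶜ∇₄A̲ + ½tr X A̲` L85–94, `ᶜ∇₄B̲ + ᶜ𝒟P` L75–79,
  `ᶜ∇₄P − ½ᶜ𝒟·B̄` L49–61), Proposition 2.4.14 (null structure equations; the row
  `ᶜ∇₄X̲̂ + ½tr X X̲̂` p0117 L95–104 and the row `ᶜ∇₄tr X + ½(tr X)²` p0117 L112–116), the
  commutator (4.2.13) of Lemma 4.2.2 for `F ∈ 𝔰₁(ℂ)` of conformal type `s` (p0163 L4–15; App. D.10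
  quotes its instance `F = B̲`, `s = −1`, cf. App. D.8 p0909 L63 "to `F = B̲` and `s = −1`"), the
  relations (4.1.13) (p0159 L72–89: the rows `ᶜ𝒟̂⊗H̲ + H̲⊗̂H̲`, `∇₄H̲ + tr X H̲`, `ᶜ𝒟tr X +
  2tr X H̲ ∈ r⁻¹𝔡^{≤1}Γ_g`), the Leibniz rule `𝒟̂⊗(hF) = h𝒟̂⊗F + 𝒟(h)⊗̂F` of Lemma 2.4.6 (2.4.4)
  (p0112 L16–29, the row L18–22), the symmetry of `⊗̂` (Definition 2.1.12, p0069 L11–24),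
  Definition 5.3.1 of `𝔮̲` with (5.3.2), (5.3.3) (p0199 L40–76: `𝔮̲ = q̄q³Q̲(A̲) = q̄q³(ᶜ∇₄ᶜ∇₄A̲ +
  C̲₁ᶜ∇₄A̲ + C̲₂A̲)`, `C̲₁ = 2tr χ − 2ªtr χ²/tr χ − 4iªtr χ`, `C̲₂ = ½tr χ² − 4ªtr χ² + (3/2)ªtr
  χ⁴/tr χ² + i(−2tr χ ªtr χ + 4ªtr χ³/tr χ)`), the renormalised component `A̲₄ = ᶜ∇₄A̲ + ½tr X A̲`
  (§5.3.1, p0198 L16–20, "see Definition 2.4.16"), `tr X = tr χ − iªtr χ` (Definition 2.4.8, p0113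
  L29–58: "In particular, note that `tr X = tr χ − iªtr χ`", L50–51) and the identity (D.5.6) of Lemma
  D.5.4 `ᶜ𝒟P = −3PH̲ + ᶜ𝒟P̌ + r⁻³Γ_g` (p0869 L5–15).
  **Locator convention (as in the siblings `TeukolskyAbarWaveLedger`, `PWaveEquationLedger`): `[J]` pages are the FILE pages
  `p0NNN` of the materialised journal PDF (= printed folio + 1), `Lnn` the line of the text layer
  of that file.**  The text layer drops under-bars, over-bars, hats and checks; every barred symbol
  below was read on the `[v1]` TeX source, the `[J]` locus is given for position, and the two texts
  were collated display by display (they agree throughout D.10 and in Proposition 5.6.1).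
* `[v1]` the same authors, arXiv:2205.14808 (v1), TeX source `FinalKerrarxivversion.tex`, lines
  `l.N`: Proposition `PROP:RELATION-QF-P` (= `prop:Formula-qf-DDhotDDPc-ch5`) l.9499–9519 ((5.6.1)
  l.9504–9510, (5.6.2) l.9512–9517), App. `proof-relation-qf-P` ("Proof of Proposition
  \ref{PROP:RELATION-QF-P}") = `[J]` D.10 l.37687–37815 (`eq:intermediate-relation-qfb-P` =
  (D.10.1) l.37742–37748); the quoted inputs Proposition `prop:bianchi:complex-conf` l.5255–5270
  (rows l.5269, l.5267, l.5263), Proposition `prop-nullstr:complex-conf` l.5226–5252 (rows l.5239,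
  l.5242), `eq:comm-nabc4nabc3-DDchot-err` = (4.2.13) l.7407–7413 (applied to `B̲`, `s = −1`:
  l.36940, l.35564), `eq:vanishing-relations-perturbations` = (4.1.13) l.7250–7260 (rows l.7254,
  l.7255, l.7256), Lemma 2.4.6 = l.4979–4986 (`DD-hot-hF` l.4983), `\widehat{\otimes}` l.2753–2770,
  Definition `Definition:Define-qfb` l.9094–9106 ((5.3.2) `eq:definition-qfb` l.9097–9099, (5.3.3)
  `eq:Cb1-Cb2-comparison-Ma` l.9101–9106), `A̲₄` l.9036–9040, Definition
  `def:complexRicciandcurvaturecoefficients` = 2.4.8 l.5041–5055 (`\tr X = \trch-i\atrch` l.5053),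
  Lemma `remark:DDcP-DDcov{P}` with `eq:error-DDP` = (D.5.6) l.35475–35483.  Proposition 5.6.1 is used in `[J]` Chapter 14: Lemma
  14.1.7 (p0634 L22–43 =
  `[v1]` `Lemma:Formula-qf-DDhotDDPc` l.26236–26250, "follows immediately from Proposition 5.6.1")
  in the proof of Theorem 14.1.3 (p0634 L20–21; `[v1]` `theorem:Morawetz-EnergyPc`, Step 10 l.26699).

## What is transcribed

App. D.10 applies `ᶜ∇₄` to the Bianchi identity `ᶜ∇₄A̲ + ½tr X A̲ = −½ᶜ𝒟̂⊗B̲ − 2H̲⊗̂B̲ − 3PX̲̂`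
("we infer", p0932 L5–22), inserts the commutator (4.2.13) for `[ᶜ∇₄, ᶜ𝒟̂⊗]B̲` ("we have", p0932
L24–62), the Bianchi identities for `ᶜ∇₄B̲`, `ᶜ∇₄P` and the null structure equation for `ᶜ∇₄X̲̂`
("we deduce", p0932 L64–136), the Leibniz rule (2.4.4) ("which gives", p0933 L5–40), the Bianchi
identity for `ᶜ∇₄A̲` once more ("Using that … we have", p0933 L43–74) and the rows of (4.1.13) for
`ᶜ∇₄H̲`, `ᶜ𝒟tr X` ("Using (4.1.13), we deduce that `½𝒟tr X − 2∇₄H̲ = tr XH̲ + r⁻¹𝔡^{≤1}Γ_g`,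
which gives" (D.10.1), p0933 L77–105).  It then rewrites the left-hand side ("Consider the LHS of
(D.10.1)", p0933 L107–131), compares it with the definition (5.3.2)/(5.3.3) of `𝔮̲` (p0933
L132–153), writes `ᶜ∇₄A̲ = A̲₄ − ½tr X A̲` (p0934 L5–53; the alternative "Using again the Bianchi
identity for `A̲₄`", p0934 L54–56, is not typed), rewrites the right-hand side with (D.5.6) (p0934
L57–95) and with `ᶜ𝒟̂⊗H̲ = −H̲⊗̂H̲ + r⁻¹𝔡^{≤1}Γ_g` (p0934 L96–144; "The above can be further
simplified", p0935 L5–13, is `O(·)`-sorting only), and combines ("By combining the above with the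
LHS, we obtain … or … as stated", p0935 L15–35; the "or" form, with `O(ar⁻³)𝔡^{≤1}B̲` in place of
`O(ar⁻²)A̲₄`, rests on the untyped alternative and is, multiplied by `q̄q³`, the statement (5.6.2)).

## How it is typed (the scalar–module shadow of the siblings; nothing tensorial is derived)

* Scalars: an abstract field `K` (`CharZero` where printed fractions are combined); `x = tr X`,
  `xbc = conj(tr X̲)`, `p = P`, `s` the conformal type, `trch = tr χ`, `atrch = ªtr χ`, `i` with
  `i² = −1` (`x = trch − i·atrch` a hypothesis where the text passes from `tr X` to `tr χ, ªtr χ`),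
  and the scalar pairings the text keeps whole: `divBc = ᶜ𝒟·B̄`, `HBc = H̲·B̄`, `XiBb = Ξ̄·B̲`,
  `GbA = ¼X̲̂·Ā` (the `Γ_b·A`-type product of the `ᶜ∇₄P` row), `e6 = ᶜ∇₄tr X + ½(tr X)²` (the
  text's "`∇₄tr X + ½(tr X)² = r⁻¹𝔡^{≤1}Ξ + Γ_g·Γ_g`", p0933 L107–110, i.e. the right-hand side
  `ᶜ𝒟·Ξ̄ + Ξ·H̄ + Ξ̄·H − ½X̂·conj X̂` of the row `ᶜ∇₄tr X + ½(tr X)²` of Proposition 2.4.14).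
  `ᶜ∇₄` on scalars is a derivation `D4 : Derivation ℤ K K` (it kills numerals, `D_num` of the
  sibling `GRWTransformationAlgebra`, imported and used BY NAME together with `CovD`, `C1`, `C2`,
  `qfrak`).
* One-forms `𝔰₁(ℂ)`: a `K`-module `M₁` with `ᶜ∇₄` a `CovD D4 M₁` (`N4`); elements `Bu = B̲`,
  `Hu = H̲`, `Xi = Ξ`, `Xib = Ξ̲`, `DP = ᶜ𝒟P`, `DPc = ᶜ𝒟P̌`, `Dx = ᶜ𝒟(tr X)`, and the whole
  products `GbB = B̄·X̲̂` (the `Γ_b·B` term of the `ᶜ∇₄B̲` row), `XiA = −½A̲·Ξ̄` (its `Ξ·A̲` term),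
  `N3B = ᶜ∇₃B̲`, the (4.1.13) elements `E4 = ∇₄H̲ + tr X H̲`, `E5 = ᶜ𝒟tr X + 2tr X H̲` of
  `r⁻¹𝔡^{≤1}Γ_g` and the remainder `E7` (= the `r⁻³Γ_g`) of (D.5.6).
* Symmetric traceless 2-tensors `𝔰₂(ℂ)`: a `K`-module `M₂` with `ᶜ∇₄` a `CovD D4 M₂` (`T4`);
  elements `A = A̲`, `Xbh = X̲̂`, `Xh = X̂`, `A4 = A̲₄`, `QA = Q̲(A̲) = ᶜ∇₄ᶜ∇₄A̲ + C̲₁ᶜ∇₄A̲ + C̲₂A̲`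
  (so that `𝔮̲ = q̄q³Q̲(A̲)` is `qfrak T4 (q̄q³) C̲₁ C̲₂ A̲` of the sibling, `D10_qfrak`), `comm =
  [ᶜ∇₄, ᶜ𝒟̂⊗]B̲ := ᶜ∇₄ᶜ𝒟̂⊗B̲ − ᶜ𝒟̂⊗ᶜ∇₄B̲`, `E1` the remainder `r⁻¹Γ_g·𝔡^{≤1}F` of (4.2.13), `E3
  = ᶜ𝒟̂⊗H̲ + H̲⊗̂H̲` (the (4.1.13) element of `r⁻¹𝔡^{≤1}Γ_g`).  `⊗̂ : M₁ →ₗ M₁ →ₗ M₂` is `K`-bilinear and symmetric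
  (`hsym`, Definition 2.1.12), `ᶜ𝒟̂⊗ : M₁ →+ M₂` is additive with the two displayed instances of
  the Leibniz rule of Lemma 2.4.6 the text uses as hypotheses (`hL1`, `hL2`), and the product rule
  `ᶜ∇₄(H̲⊗̂B̲) = H̲⊗̂ᶜ∇₄B̲ + ᶜ∇₄H̲⊗̂B̲` the text uses in "we infer" is the hypothesis `hd4HB`.
* Every quoted input enters as a HYPOTHESIS in the displayed form (the Bianchi / null-structure
  rows exactly as App. D.10 quotes them — the `ᶜ∇₄B̲` row with `+Γ_b·B + Ξ·A̲` for the printed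
  `+B̄·X̲̂ − ½A̲·Ξ̄` of Proposition 2.4.15, the `ᶜ∇₄P` row with `+H̲·B̄ + Ξ·B̲ + Γ_b·A` for
  `+H̲·B̄ − Ξ̄·B̲ − ¼X̲̂·Ā`: whole opaque terms, signs immaterial), every "we infer / we have / we
  deduce / which gives / we obtain / LHS = / RHS =" display is a THEOREM, each taking the previous
  display as a hypothesis, and `D10_prop561_exact` composes them all from the primitive hypotheses.
* SCHEMATIC TERMS.  The text's `O(·)`, `r⁻ᵏ𝔡^{≤1}Γ`, `l.o.t.`-type terms are carried EXACTLY: the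
  kernel keeps `−½Ξ⊗̂ᶜ∇₃B̲ − ½E1` where the text prints the commutator's contribution schematically
  as `+Ξ⊗̂∇₃B̲ + r⁻¹Γ_g·𝔡^{≤1}B̲` (p0932 L61–62), keeps `½e6·A̲` where the text prints
  `r⁻¹𝔡^{≤1}Ξ·A̲` (p0933 L128–131), and lists in `D10_prop561_exact` every term the statement
  (5.6.2) files under `r⁻⁴𝔡̸^{≤1}(Γ_b, rΓ_g) + O(ar⁻²)A̲₄ + O(ar⁻⁴)A̲ + O(ar⁻³)𝔡^{≤1}P̌ + …` with
  its exact coefficient.  Nothing is absorbed; the grouping into `O(·)` classes is the text's and is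
  not a kernel statement.

## Certified (0 sorry; axioms reported by the gate)

Every display of App. D.10 reproduces from the quoted inputs with every printed coefficient,
including: the `¼tr X(ᶜ𝒟̂⊗B̲ + 2H̲⊗̂B̲)` of "we have" (from `s = −1`); the `5/2`, `6PX̲̂·tr X`
bookkeeping of "we deduce"/"which gives" (`(½𝒟tr X − 2∇₄H̲)⊗̂B̲`, `(4𝒟P + 6PH̲)⊗̂H̲`, using the
symmetry of `⊗̂` once for `H̲⊗̂𝒟P`); (D.10.1); the left-hand side `ᶜ∇₄ᶜ∇₄A̲ + 2tr Xᶜ∇₄A̲ +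
½(tr X)²A̲ + ½(ᶜ∇₄tr X + ½(tr X)²)A̲`; the two coefficient identities against (5.3.3), `2tr X −
C̲₁ = 2ªtr χ²/tr χ + 2iªtr χ` and `½(tr X)² − C̲₂ = −(3/2)ªtr χ⁴/tr χ² + (7/2)ªtr χ² + i tr χ ªtr χ
− 4iªtr χ³/tr χ` (`D10_coeff`, using `i² = −1` only); the `A̲₄`-rewrite with the printed
`A̲`-coefficient `−(3/2)ªtr χ⁴/tr χ² + (3/2)ªtr χ² − 3iªtr χ³/tr χ` (`tr χ ≠ 0`); the right-hand
side through (D.5.6) (`−(3/2)𝒟P⊗̂H̲ − (3/2)P𝒟̂⊗H̲`, `(4𝒟P̌ − 6PH̲ + tr X B̲)⊗̂H̲`) and through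
`ᶜ𝒟̂⊗H̲ = −H̲⊗̂H̲ + …` (the `P·H̲⊗̂H̲` terms cancel: `9/2 + 3/2 − 6 = 0`; the `(5/2)𝒟P̌⊗̂H̲`); and
the exact form of "By combining": `Q̲(A̲) = ½ᶜ𝒟̂⊗ᶜ𝒟P̌ + (5/2)ᶜ𝒟P̌⊗̂H̲ + tr X B̲⊗̂H̲ + (3/2)P(tr X
X̲̂ + conj(tr X̲)X̂) − (2ªtr χ²/tr χ + 2iªtr χ)A̲₄ − (−(3/2)ªtr χ⁴/tr χ² + (3/2)ªtr χ² − 3iªtr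
χ³/tr χ)A̲ − ½(ᶜ∇₄tr X + ½(tr X)²)A̲ + (exact remainder)` — the `A̲₄`-form of the text's last-but-one
display (p0935 L15–23) with every coefficient explicit; (5.6.1) itself is `D10_1` with `D10_LHS`
(READING NOTE (2)).  (Any replay of this bookkeeping outside the kernel in a COMMUTATIVE symbol model —
`⊗̂` a commutative product of symbols, `ᶜ𝒟̂⊗` of a basic one-form an opaque symbol — checks
coefficients only, not tensor calculus, and is no part of this certificate; here too nothing
tensorial is derived: `⊗̂` is an abstract symmetric bilinear map, `ᶜ𝒟̂⊗` an abstract additive map,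
and every Leibniz / commutator / product-rule row enters verbatim as a hypothesis.)

PRINT DATA: none — `[J]` App. D.10 and Proposition 5.6.1 agree with `[v1]` token for token in every
display, and every display reproduces.  READING NOTES (no effect on any display): (1) the commutator
enters (D.10)'s second display with the factor `−½` of "we infer", so its `Ξ⊗̂∇₃B̲` and
`r⁻¹Γ_g·𝔡^{≤1}B̲` terms carry `−½` in the kernel where the text, treating them as acceptable error
terms from that line on, prints them unsigned; (2) (5.6.1) is (D.10.1) with the left-hand side
expanded, the term `½(ᶜ∇₄tr X + ½(tr X)²)A̲` of `D10_LHS` (the text's `r⁻¹𝔡^{≤1}Ξ·A̲`, p0933 L130)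
being filed under its `r⁻¹𝔡^{≤1}(Ξ·A̲)`; (3) the `A̲`-coefficient of the `A̲₄`-form is printed
`O(a²r⁻⁴)A̲` at p0934 L53 and `O(ar⁻⁴)A̲` at p0935 L19 (both `[J]` = `[v1]`), (5.6.2) printing
`O(a²)A̲` after the factor `q̄q³`; the kernel's coefficient is `−(−(3/2)ªtr χ⁴/tr χ² + (3/2)ªtr χ² −
3iªtr χ³/tr χ) − ½e6`.

NOT CLAIMED: that the hypotheses hold for the geometric objects of `[J]` (they are the quoted
displays, under the programme's census like every displayed input); the `O(·)` / `r⁻ᵏ𝔡Γ` classes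
into which (5.6.1), (5.6.2) and Lemma 14.1.7 sort the exact remainder; the alternative form "Using
again the Bianchi identity for `A̲₄`" (p0934 L54–56) behind (5.6.2); anything about Chapter 14.
-/

namespace Literature.Geometry.Lorentzian.GiorgiKlainermanSzeftel2022.QfbPRelationLedger

open Literature.Geometry.Lorentzian.GiorgiKlainermanSzeftel2022.GRWTransformationAlgebra

variable {K : Type*} [Field K]

/-! ## §0 Two scalar helpers (`D_half` private) -/

/-- A derivation kills `½` (from `D 2 = 0`, `D 1 = 0` and the Leibniz rule on `2·½ = 1`); private
helper for `D_half_mul` and `D10_infer`. [folklore] -/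
private theorem D_half [CharZero K] (D : Derivation ℤ K K) : D (1 / 2 : K) = 0 := by
  obtain ⟨h2, -, -, -, -⟩ := D_num D
  have h := D.leibniz (2 : K) (1 / 2)
  rw [show (2 : K) * (1 / 2) = 1 by norm_num, D.map_one_eq_zero, h2, smul_zero, add_zero,
    smul_eq_mul] at h
  linear_combination (-(1 / 2) : K) * h

/-- `ᶜ∇₄(½tr X) = ½ᶜ∇₄tr X` (the step "`∇₄(∇₄A̲ + ½tr XA̲) = ∇₄∇₄A̲ + ½tr X∇₄A̲ + ½∇₄tr X A̲`" of
"Consider the LHS", p0933 L109–122). [folklore]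
[cite: GiorgiKlainermanSzeftel2024, p0933 L109–122; GiorgiKlainermanSzeftel2022, l.37752–37753] -/
theorem D_half_mul [CharZero K] (D : Derivation ℤ K K) (x : K) : D (1 / 2 * x) = 1 / 2 * D x := by
  rw [D.leibniz, D_half D, smul_zero, add_zero, smul_eq_mul]

section AppD10

variable {M₁ : Type*} [AddCommGroup M₁] [Module K M₁]
variable {M₂ : Type*} [AddCommGroup M₂] [Module K M₂]

/-! ## §1 "Applying `ᶜ∇₄` to [the Bianchi identity for `ᶜ∇₄A̲`] we infer" -/

/-- From the Bianchi identity "`ᶜ∇₄A̲ + ½tr X A̲ = −½ᶜ𝒟̂⊗B̲ − 2H̲⊗̂B̲ − 3PX̲̂`" (`hBA`, the row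
`ᶜ∇₄A̲ + ½tr X A̲` of Proposition 2.4.15 as App. D.10 quotes it, p0931 L76–86), the definition of the
commutator `[ᶜ∇₄, ᶜ𝒟̂⊗]B̲ = ᶜ∇₄ᶜ𝒟̂⊗B̲ − ᶜ𝒟̂⊗ᶜ∇₄B̲` (`hcomm`) and the product rule `ᶜ∇₄(H̲⊗̂B̲) =
H̲⊗̂ᶜ∇₄B̲ + ᶜ∇₄H̲⊗̂B̲` (`hd4HB`): "we infer `ᶜ∇₄(ᶜ∇₄A̲ + ½tr XA̲) = −½ᶜ𝒟̂⊗ᶜ∇₄B̲ − ½[ᶜ∇₄, ᶜ𝒟̂⊗]B̲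
− 2H̲⊗̂ᶜ∇₄B̲ − 2ᶜ∇₄H̲⊗̂B̲ − 3Pᶜ∇₄X̲̂ − 3ᶜ∇₄(P)X̲̂`".
[cite: GiorgiKlainermanSzeftel2024, p0931 L72 – p0932 L22, Proposition 2.4.15 p0118 L85–94; GiorgiKlainermanSzeftel2022, l.37692–37700, l.5269] -/
theorem D10_infer [CharZero K] {D4 : Derivation ℤ K K} (N4 : CovD D4 M₁) (T4 : CovD D4 M₂)
    (hot : M₁ →ₗ[K] M₁ →ₗ[K] M₂) (Dhot : M₁ →+ M₂) (x p : K) (Bu Hu : M₁) (A Xbh comm : M₂)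
    (hBA : T4.op A + (1 / 2 * x) • A
      = -((1 / 2 : K) • Dhot Bu) - (2 : K) • hot Hu Bu - (3 * p) • Xbh)
    (hcomm : comm = T4.op (Dhot Bu) - Dhot (N4.op Bu))
    (hd4HB : T4.op (hot Hu Bu) = hot Hu (N4.op Bu) + hot (N4.op Hu) Bu) :
    T4.op (T4.op A + (1 / 2 * x) • A)
      = -((1 / 2 : K) • Dhot (N4.op Bu)) - (1 / 2 : K) • comm - (2 : K) • hot Hu (N4.op Bu)
        - (2 : K) • hot (N4.op Hu) Bu - (3 * p) • T4.op Xbh - (3 * D4 p) • Xbh := by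
  obtain ⟨h2, h3, -, -, -⟩ := D_num D4
  rw [hBA, hcomm]
  simp only [map_sub, map_neg, T4.leibniz, D4.leibniz, D_half D4, h2, h3, hd4HB, zero_smul,
    zero_add, add_zero, smul_eq_mul, mul_zero]
  module

/-! ## §2 "Using the commutator (4.2.13) … we have" -/

/-- "Using the commutator (4.2.13), i.e. `[ᶜ∇₄, ᶜ𝒟̂⊗]B̲ = −½tr X(ᶜ𝒟̂⊗B̲ + 2H̲⊗̂B̲) + H̲⊗̂ᶜ∇₄B̲ +
Ξ⊗̂ᶜ∇₃B̲ + r⁻¹Γ_g·𝔡^{≤1}B̲`" — the instance `F = B̲`, `s = −1` (`hs`; cf. App. D.8 p0909 L63) of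
(4.2.13) "`[ᶜ∇₄, ᶜ𝒟̂⊗]F = −½tr X(ᶜ𝒟̂⊗F + (1 − s)H̲⊗̂F) + H̲⊗̂ᶜ∇₄F + Ξ⊗̂ᶜ∇₃F + r⁻¹Γ_g·𝔡^{≤1}F`"
(`hC`; `E1` the last term, `N3B = ᶜ∇₃B̲`) —, the display of §1 (`hinf`) becomes: "we have `ᶜ∇₄(ᶜ∇₄A̲ + ½tr XA̲) = −½ᶜ𝒟̂⊗ᶜ∇₄B̲ − (5/2)H̲⊗̂ᶜ∇₄B̲ + ¼tr X(ᶜ𝒟̂⊗B̲ + 2H̲⊗̂B̲)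
− 2ᶜ∇₄H̲⊗̂B̲ − 3Pᶜ∇₄X̲̂ − 3ᶜ∇₄(P)X̲̂ + Ξ⊗̂∇₃B̲ + r⁻¹Γ_g·𝔡^{≤1}B̲`" — the last two terms being, in the
kernel, `−½Ξ⊗̂ᶜ∇₃B̲ − ½E1` (READING NOTE (1) of the module docstring).
[cite: GiorgiKlainermanSzeftel2024, p0932 L24–62, (4.2.13) p0163 L4–15, p0909 L63; GiorgiKlainermanSzeftel2022, l.37701–37712, l.7407–7413, l.36940] -/
theorem D10_have [CharZero K] {D4 : Derivation ℤ K K} (N4 : CovD D4 M₁) (T4 : CovD D4 M₂)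
    (hot : M₁ →ₗ[K] M₁ →ₗ[K] M₂) (Dhot : M₁ →+ M₂) (x p s : K) (Bu Hu Xi N3B : M₁)
    (A Xbh comm E1 : M₂)
    (hinf : T4.op (T4.op A + (1 / 2 * x) • A)
      = -((1 / 2 : K) • Dhot (N4.op Bu)) - (1 / 2 : K) • comm - (2 : K) • hot Hu (N4.op Bu)
        - (2 : K) • hot (N4.op Hu) Bu - (3 * p) • T4.op Xbh - (3 * D4 p) • Xbh)
    (hC : comm = -((1 / 2 * x) • (Dhot Bu + (1 - s) • hot Hu Bu)) + hot Hu (N4.op Bu)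
      + hot Xi N3B + E1)
    (hs : s = -1) :
    T4.op (T4.op A + (1 / 2 * x) • A)
      = -((1 / 2 : K) • Dhot (N4.op Bu)) - (5 / 2 : K) • hot Hu (N4.op Bu)
        + (1 / 4 * x) • (Dhot Bu + (2 : K) • hot Hu Bu) - (2 : K) • hot (N4.op Hu) Bu
        - (3 * p) • T4.op Xbh - (3 * D4 p) • Xbh
        - (1 / 2 : K) • hot Xi N3B - (1 / 2 : K) • E1 := by
  subst hs
  rw [hinf, hC]
  module

/-! ## §3 "Next, using [the Bianchi identities for `ᶜ∇₄B̲`, `ᶜ∇₄P`, the null structure equation for `ᶜ∇₄X̲̂`] we deduce" -/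

/-- With the quoted rows "`ᶜ∇₄B̲ + ᶜ𝒟P = −tr XB̲ − 3PH̲ + Γ_b·B + Ξ·A̲`" (`hB`; `GbB`, `XiA` the two
products, Proposition 2.4.15's `+B̄·X̲̂ − ½A̲·Ξ̄`), "`ᶜ∇₄P − ½ᶜ𝒟·B̄ = −(3/2)tr XP + H̲·B̄ + Ξ·B̲ +
Γ_b·A`" (`hP`) and "`ᶜ∇₄X̲̂ + ½tr X X̲̂ = ½ᶜ𝒟̂⊗H̲ + ½H̲⊗̂H̲ − ½conj(tr X̲)X̂ + ¼Ξ⊗̂Ξ̲`" (`hX`,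
Proposition 2.4.14) inserted into the display of §2 (`hhave`): "Next, using … we deduce `ᶜ∇₄(ᶜ∇₄A̲ + ½tr XA̲) =
½ᶜ𝒟̂⊗(𝒟P + tr XB̲ + 3PH̲) + (5/2)H̲⊗̂(𝒟P + tr XB̲ + 3PH̲) + ¼tr X(𝒟̂⊗B̲ + 2H̲⊗̂B̲) − 2∇₄H̲⊗̂B̲ −
3P(−½tr X X̲̂ + ½𝒟̂⊗H̲ + ½H̲⊗̂H̲ − ½conj(tr X̲)X̂) − 3(−(3/2)tr XP)X̲̂ + Ξ⊗̂∇₃B̲ + r⁻¹𝔡^{≤1}(Ξ·A̲) +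
r⁻¹Γ_g·𝔡^{≤1}B̲ + r⁻¹𝔡^{≤1}(Γ_b·B) + r⁻³Ξ·Ξ̲`", the remainder being, exactly, `R` (`hR`: the
commutator terms of §2, `−½ᶜ𝒟̂⊗(Γ_b·B + Ξ·A̲) − (5/2)H̲⊗̂(Γ_b·B + Ξ·A̲)`, `−3(½ᶜ𝒟·B̄ + H̲·B̄ + Ξ·B̲ +
Γ_b·A)X̲̂`, `−(3/4)PΞ⊗̂Ξ̲`).
[cite: GiorgiKlainermanSzeftel2024, p0932 L64–136, Proposition 2.4.15 p0118 L49–79, Proposition 2.4.14 p0117 L95–104; GiorgiKlainermanSzeftel2022, l.37713–37726, l.5263, l.5267, l.5239] -/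
theorem D10_deduce [CharZero K] {D4 : Derivation ℤ K K} (N4 : CovD D4 M₁) (T4 : CovD D4 M₂)
    (hot : M₁ →ₗ[K] M₁ →ₗ[K] M₂) (Dhot : M₁ →+ M₂) (x xbc p divBc HBc XiBb GbA : K)
    (Bu Hu Xi Xib DP GbB XiA N3B : M₁) (A Xbh Xh E1 R : M₂)
    (hhave : T4.op (T4.op A + (1 / 2 * x) • A)
      = -((1 / 2 : K) • Dhot (N4.op Bu)) - (5 / 2 : K) • hot Hu (N4.op Bu)
        + (1 / 4 * x) • (Dhot Bu + (2 : K) • hot Hu Bu) - (2 : K) • hot (N4.op Hu) Bu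
        - (3 * p) • T4.op Xbh - (3 * D4 p) • Xbh
        - (1 / 2 : K) • hot Xi N3B - (1 / 2 : K) • E1)
    (hB : N4.op Bu + DP = -(x • Bu) - (3 * p) • Hu + GbB + XiA)
    (hP : D4 p - 1 / 2 * divBc = -(3 / 2) * x * p + HBc + XiBb + GbA)
    (hX : T4.op Xbh + (1 / 2 * x) • Xbh
      = (1 / 2 : K) • Dhot Hu + (1 / 2 : K) • hot Hu Hu - (1 / 2 * xbc) • Xh
        + (1 / 4 : K) • hot Xi Xib)
    (hR : R = -((1 / 2 : K) • hot Xi N3B) - (1 / 2 : K) • E1 - (1 / 2 : K) • Dhot (GbB + XiA)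
      - (5 / 2 : K) • hot Hu (GbB + XiA) - (3 * (1 / 2 * divBc + HBc + XiBb + GbA)) • Xbh
      - (3 / 4 * p) • hot Xi Xib) :
    T4.op (T4.op A + (1 / 2 * x) • A)
      = (1 / 2 : K) • Dhot (DP + x • Bu + (3 * p) • Hu)
        + (5 / 2 : K) • hot Hu (DP + x • Bu + (3 * p) • Hu)
        + (1 / 4 * x) • (Dhot Bu + (2 : K) • hot Hu Bu) - (2 : K) • hot (N4.op Hu) Bu
        - (3 * p) • (-((1 / 2 * x) • Xbh) + (1 / 2 : K) • Dhot Hu + (1 / 2 : K) • hot Hu Hu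
          - (1 / 2 * xbc) • Xh)
        - (3 * (-(3 / 2) * x * p)) • Xbh + R := by
  have hB' : N4.op Bu = -(DP + x • Bu + (3 * p) • Hu) + (GbB + XiA) := by
    linear_combination (norm := module) hB
  have hP' : D4 p = -(3 / 2) * x * p + (1 / 2 * divBc + HBc + XiBb + GbA) := by
    linear_combination hP
  have hX' : T4.op Xbh = -((1 / 2 * x) • Xbh) + (1 / 2 : K) • Dhot Hu + (1 / 2 : K) • hot Hu Hu
      - (1 / 2 * xbc) • Xh + (1 / 4 : K) • hot Xi Xib := by
    linear_combination (norm := module) hX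
  rw [hhave, hR, hB', hP', hX']
  simp only [map_add, map_neg, map_smul]
  module

/-! ## §4 "which gives" (the Leibniz rule of Lemma 2.4.6 for `ᶜ𝒟̂⊗(tr XB̲)`, `ᶜ𝒟̂⊗(3PH̲)`) -/

/-- With the two instances "`ᶜ𝒟̂⊗(tr XB̲) = tr Xᶜ𝒟̂⊗B̲ + ᶜ𝒟tr X⊗̂B̲`" (`hL1`; `Dx = ᶜ𝒟tr X`),
"`ᶜ𝒟̂⊗(3PH̲) = 3Pᶜ𝒟̂⊗H̲ + 3ᶜ𝒟P⊗̂H̲`" (`hL2`) of the Leibniz rule `𝒟̂⊗(hF) = h𝒟̂⊗F + 𝒟(h)⊗̂F` of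
Lemma 2.4.6 (2.4.4) (as the display uses it, for the conformal operators) and the symmetry of `⊗̂`
(`hsym`, Definition 2.1.12), the display of §3 (`hded`) becomes: "which gives `ᶜ∇₄(ᶜ∇₄A̲ + ½tr XA̲) = ½ᶜ𝒟̂⊗𝒟P −
(3/2)tr X(−½ᶜ𝒟̂⊗B̲ − 2H̲⊗̂B̲ − 3PX̲̂) + 3P(½tr X X̲̂ + ½conj(tr X̲)X̂) + (½𝒟tr X − 2∇₄H̲)⊗̂B̲ + (4𝒟P
+ 6PH̲)⊗̂H̲ + [R]`" (the `P·ᶜ𝒟̂⊗H̲` terms cancel: `3/2 − 3/2`; `H̲⊗̂B̲`: `5/2 + 1/2 = 3`; `PX̲̂ tr X`: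
`3/2 + 9/2 = 6`; `𝒟P⊗̂H̲`: `3/2 + 5/2 = 4`; `PH̲⊗̂H̲`: `15/2 − 3/2 = 6`).
[cite: GiorgiKlainermanSzeftel2024, p0933 L5–40, Lemma 2.4.6 (2.4.4) p0112 L16–29, Definition 2.1.12 p0069 L11–24; GiorgiKlainermanSzeftel2022, l.37727–37733, l.4979–4986, l.2755–2770] -/
theorem D10_gives [CharZero K] {D4 : Derivation ℤ K K} (N4 : CovD D4 M₁) (T4 : CovD D4 M₂)
    (hot : M₁ →ₗ[K] M₁ →ₗ[K] M₂) (Dhot : M₁ →+ M₂) (x xbc p : K)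
    (Bu Hu DP Dx : M₁) (A Xbh Xh R : M₂)
    (hded : T4.op (T4.op A + (1 / 2 * x) • A)
      = (1 / 2 : K) • Dhot (DP + x • Bu + (3 * p) • Hu)
        + (5 / 2 : K) • hot Hu (DP + x • Bu + (3 * p) • Hu)
        + (1 / 4 * x) • (Dhot Bu + (2 : K) • hot Hu Bu) - (2 : K) • hot (N4.op Hu) Bu
        - (3 * p) • (-((1 / 2 * x) • Xbh) + (1 / 2 : K) • Dhot Hu + (1 / 2 : K) • hot Hu Hu
          - (1 / 2 * xbc) • Xh)
        - (3 * (-(3 / 2) * x * p)) • Xbh + R)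
    (hL1 : Dhot (x • Bu) = x • Dhot Bu + hot Dx Bu)
    (hL2 : Dhot ((3 * p) • Hu) = (3 * p) • Dhot Hu + (3 : K) • hot DP Hu)
    (hsym : ∀ F G : M₁, hot F G = hot G F) :
    T4.op (T4.op A + (1 / 2 * x) • A)
      = (1 / 2 : K) • Dhot DP
        - (3 / 2 * x) • (-((1 / 2 : K) • Dhot Bu) - (2 : K) • hot Hu Bu - (3 * p) • Xbh)
        + (3 * p) • ((1 / 2 * x) • Xbh + (1 / 2 * xbc) • Xh)
        + hot ((1 / 2 : K) • Dx - (2 : K) • N4.op Hu) Bu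
        + hot ((4 : K) • DP + (6 * p) • Hu) Hu + R := by
  rw [hded]
  simp only [map_add, map_sub, map_smul, LinearMap.add_apply, LinearMap.sub_apply,
    LinearMap.smul_apply, hL1, hL2]
  rw [hsym Hu DP]
  module

/-! ## §5 "Using that `ᶜ∇₄A̲ + ½tr XA̲ = −½ᶜ𝒟̂⊗B̲ − 2H̲⊗̂B̲ − 3PX̲̂`, we have" -/

/-- Moving `−(3/2)tr X(−½ᶜ𝒟̂⊗B̲ − 2H̲⊗̂B̲ − 3PX̲̂) = −(3/2)tr X(ᶜ∇₄A̲ + ½tr XA̲)` (`hBA`) to the left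
of the display of §4 (`hgiv`): "we have `ᶜ∇₄(ᶜ∇₄A̲ + ½tr XA̲) + (3/2)tr X(ᶜ∇₄A̲ + ½tr XA̲) = ½ᶜ𝒟̂⊗𝒟P
+ (3/2)P(tr X X̲̂ + conj(tr X̲)X̂) + (½𝒟tr X − 2∇₄H̲)⊗̂B̲ + (4𝒟P + 6PH̲)⊗̂H̲ + [R]`".
[cite: GiorgiKlainermanSzeftel2024, p0933 L43–74; GiorgiKlainermanSzeftel2022, l.37734–37740] -/
theorem D10_using_BA [CharZero K] {D4 : Derivation ℤ K K} (N4 : CovD D4 M₁) (T4 : CovD D4 M₂)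
    (hot : M₁ →ₗ[K] M₁ →ₗ[K] M₂) (Dhot : M₁ →+ M₂) (x xbc p : K)
    (Bu Hu DP Dx : M₁) (A Xbh Xh R : M₂)
    (hgiv : T4.op (T4.op A + (1 / 2 * x) • A)
      = (1 / 2 : K) • Dhot DP
        - (3 / 2 * x) • (-((1 / 2 : K) • Dhot Bu) - (2 : K) • hot Hu Bu - (3 * p) • Xbh)
        + (3 * p) • ((1 / 2 * x) • Xbh + (1 / 2 * xbc) • Xh)
        + hot ((1 / 2 : K) • Dx - (2 : K) • N4.op Hu) Bu
        + hot ((4 : K) • DP + (6 * p) • Hu) Hu + R)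
    (hBA : T4.op A + (1 / 2 * x) • A
      = -((1 / 2 : K) • Dhot Bu) - (2 : K) • hot Hu Bu - (3 * p) • Xbh) :
    T4.op (T4.op A + (1 / 2 * x) • A) + (3 / 2 * x) • (T4.op A + (1 / 2 * x) • A)
      = (1 / 2 : K) • Dhot DP + (3 / 2 * p) • (x • Xbh + xbc • Xh)
        + hot ((1 / 2 : K) • Dx - (2 : K) • N4.op Hu) Bu
        + hot ((4 : K) • DP + (6 * p) • Hu) Hu + R := by
  rw [hgiv, hBA]
  module

/-! ## §6 "Using (4.1.13), we deduce that `½𝒟tr X − 2∇₄H̲ = tr XH̲ + r⁻¹𝔡^{≤1}Γ_g`, which gives" (D.10.1) -/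

/-- With the rows "`∇₄H̲ + tr X H̲ ∈ r⁻¹𝔡^{≤1}Γ_g`" (`hE4`: `E4` the element) and "`ᶜ𝒟tr X + 2tr
X H̲ ∈ r⁻¹𝔡^{≤1}Γ_g`" (`hE5`) of (4.1.13): "Using (4.1.13), we deduce that `½𝒟tr X − 2∇₄H̲ = tr
XH̲ + r⁻¹𝔡^{≤1}Γ_g`" — exactly `tr X H̲ + (½E5 − 2E4)` (the `tr X H̲` parts combine to `(−1 +
2)tr X H̲`, which (D.10.1) keeps as the `tr XB̲` of `(4𝒟P + 6PH̲ + tr XB̲)⊗̂H̲`).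
[cite: GiorgiKlainermanSzeftel2024, p0933 L77, (4.1.13) p0159 L72–89; GiorgiKlainermanSzeftel2022, l.37741, l.7250–7260] -/
theorem D10_vanishing_term [CharZero K] {D4 : Derivation ℤ K K} (N4 : CovD D4 M₁) (x : K) (Hu Dx E4 E5 : M₁)
    (hE4 : N4.op Hu + x • Hu = E4) (hE5 : Dx + (2 * x) • Hu = E5) :
    (1 / 2 : K) • Dx - (2 : K) • N4.op Hu = x • Hu + ((1 / 2 : K) • E5 - (2 : K) • E4) := by
  rw [eq_sub_of_add_eq hE4, eq_sub_of_add_eq hE5]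
  module

/-- (D.10.1): from the display of §5 (`huse`), the identity of `D10_vanishing_term` (`hvan`) and the
symmetry of `⊗̂`: "which gives `ᶜ∇₄(ᶜ∇₄A̲ + ½tr XA̲) + (3/2)tr X(ᶜ∇₄A̲ + ½tr XA̲) =
½ᶜ𝒟̂⊗𝒟P + (4𝒟P + 6PH̲ + tr XB̲)⊗̂H̲ + (3/2)P(tr X X̲̂ + conj(tr X̲)X̂) + r⁻⁴𝔡̸^{≤1}Γ_g + Ξ⊗̂∇₃B̲ +
r⁻¹𝔡^{≤1}(Ξ·A̲) + r⁻¹𝔡^{≤1}(Γ_g·B̲) + r⁻¹𝔡^{≤1}(Γ_b·B)`", the remainder being exactly `R + (½E5 −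
2E4)⊗̂B̲`.
[cite: GiorgiKlainermanSzeftel2024, p0933 L77–105 (D.10.1); GiorgiKlainermanSzeftel2022, l.37741–37748] -/
theorem D10_1 [CharZero K] {D4 : Derivation ℤ K K} (N4 : CovD D4 M₁) (T4 : CovD D4 M₂)
    (hot : M₁ →ₗ[K] M₁ →ₗ[K] M₂) (Dhot : M₁ →+ M₂) (x xbc p : K)
    (Bu Hu DP Dx E4 E5 : M₁) (A Xbh Xh R : M₂)
    (huse : T4.op (T4.op A + (1 / 2 * x) • A) + (3 / 2 * x) • (T4.op A + (1 / 2 * x) • A)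
      = (1 / 2 : K) • Dhot DP + (3 / 2 * p) • (x • Xbh + xbc • Xh)
        + hot ((1 / 2 : K) • Dx - (2 : K) • N4.op Hu) Bu
        + hot ((4 : K) • DP + (6 * p) • Hu) Hu + R)
    (hvan : (1 / 2 : K) • Dx - (2 : K) • N4.op Hu = x • Hu + ((1 / 2 : K) • E5 - (2 : K) • E4))
    (hsym : ∀ F G : M₁, hot F G = hot G F) :
    T4.op (T4.op A + (1 / 2 * x) • A) + (3 / 2 * x) • (T4.op A + (1 / 2 * x) • A)
      = (1 / 2 : K) • Dhot DP + hot ((4 : K) • DP + (6 * p) • Hu + x • Bu) Hu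
        + (3 / 2 * p) • (x • Xbh + xbc • Xh)
        + (R + hot ((1 / 2 : K) • E5 - (2 : K) • E4) Bu) := by
  rw [huse, hvan]
  simp only [map_add, map_sub, map_smul, LinearMap.add_apply, LinearMap.sub_apply,
    LinearMap.smul_apply]
  rw [hsym Hu Bu]
  module

/-! ## §7 "Consider the LHS of (D.10.1)" -/

/-- "Using that `∇₄tr X + ½(tr X)² = r⁻¹𝔡^{≤1}Ξ + Γ_g·Γ_g`" (`hx4`: `e6` the right-hand side; the row
`ᶜ∇₄tr X + ½(tr X)² = ᶜ𝒟·Ξ̄ + Ξ·H̄ + Ξ̄·H − ½X̂·conj X̂` of Proposition 2.4.14), "we obtain `LHS =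
ᶜ∇₄(ᶜ∇₄A̲ + ½tr XA̲) + (3/2)tr X(ᶜ∇₄A̲ + ½tr XA̲) = ᶜ∇₄ᶜ∇₄A̲ + ½tr Xᶜ∇₄A̲ + ½ᶜ∇₄tr X A̲ + (3/2)tr
X(ᶜ∇₄A̲ + ½tr XA̲) = ᶜ∇₄ᶜ∇₄A̲ + 2tr Xᶜ∇₄A̲ + ½(tr X)²A̲ + r⁻¹𝔡^{≤1}Ξ·A̲`" — exactly, the last term
is `½e6·A̲` (READING NOTE (2)).
[cite: GiorgiKlainermanSzeftel2024, p0933 L107–131, Proposition 2.4.14 p0117 L112–116; GiorgiKlainermanSzeftel2022, l.37750–37755, l.5242] -/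
theorem D10_LHS [CharZero K] {D4 : Derivation ℤ K K} (T4 : CovD D4 M₂) (x e6 : K) (A : M₂)
    (hx4 : D4 x + 1 / 2 * (x * x) = e6) :
    T4.op (T4.op A + (1 / 2 * x) • A) + (3 / 2 * x) • (T4.op A + (1 / 2 * x) • A)
      = T4.op (T4.op A) + (2 * x) • T4.op A + (1 / 2 * (x * x)) • A + (1 / 2 * e6) • A := by
  rw [map_add, T4.leibniz, D_half_mul, eq_sub_of_add_eq hx4]
  module

/-- The two coefficient identities behind "Using the definition (5.3.2), we deduce `LHS = Q̲(A̲) +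
(2ªtr χ²/tr χ + 2iªtr χ)ᶜ∇₄A̲ + (−(3/2)ªtr χ⁴/tr χ² + (7/2)ªtr χ² + i tr χªtr χ − 4iªtr χ³/tr χ)A̲ +
r⁻¹𝔡^{≤1}Ξ·A̲`" (where `Q̲(A̲) = ᶜ∇₄ᶜ∇₄A̲ + C̲₁ᶜ∇₄A̲ + C̲₂A̲`, (5.3.2)–(5.3.3)): with `tr X = tr χ −
iªtr χ` (Definition 2.4.8) and `C̲₁ = C1 i trch atrch`, `C̲₂ = C2 i trch atrch` of the sibling,
`2tr X − C̲₁ = 2ªtr χ²/tr χ + 2iªtr χ` and `½(tr X)² − C̲₂ = −(3/2)ªtr χ⁴/tr χ² + (7/2)ªtr χ² + i tr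
χªtr χ − 4iªtr χ³/tr χ` (only `i² = −1` is used; sign convention `tr X = tr χ − iªtr χ` of Definition
2.4.8, p0113 L50–51 = `[v1]` l.5053).
[cite: GiorgiKlainermanSzeftel2024, p0933 L132–153, (5.3.2)–(5.3.3) p0199 L45–76, Definition 2.4.8 p0113 L29–58; GiorgiKlainermanSzeftel2022, l.37756–37761, l.9097–9106, l.5053] -/
theorem D10_coeff [CharZero K] (i trch atrch : K) (hi : i ^ 2 = -1) :
    2 * (trch - i * atrch) - C1 i trch atrch = 2 * (atrch ^ 2 / trch) + 2 * i * atrch ∧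
    1 / 2 * ((trch - i * atrch) * (trch - i * atrch)) - C2 i trch atrch
      = -(3 / 2) * (atrch ^ 4 / trch ^ 2) + 7 / 2 * atrch ^ 2 + i * trch * atrch
        - 4 * i * (atrch ^ 3 / trch) := by
  unfold C1 C2
  constructor
  · ring
  · linear_combination (1 / 2 * atrch ^ 2) * hi

/-- The left-hand side of (D.10.1) against (5.3.2): with `Q̲(A̲) = ᶜ∇₄ᶜ∇₄A̲ + C̲₁ᶜ∇₄A̲ + C̲₂A̲` (`hQ`;
`QA = Q̲(A̲)`, so that `𝔮̲ = q̄q³Q̲(A̲)`, see `D10_qfrak`) and `tr X = tr χ − iªtr χ` (`hx`): "Using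
the definition (5.3.2), we deduce `LHS = Q̲(A̲) + (2ªtr χ²/tr χ + 2iªtr χ)ᶜ∇₄A̲ + (−(3/2)ªtr χ⁴/tr
χ² + (7/2)ªtr χ² + i tr χªtr χ − 4iªtr χ³/tr χ)A̲ + r⁻¹𝔡^{≤1}Ξ·A̲`" (the `r⁻¹𝔡^{≤1}Ξ·A̲` = `½e6·A̲` of
`D10_LHS` riding on both sides; the text's next line `= Q̲(A̲) + O(ar⁻³)𝔡^{≤1}A̲ + r⁻²Γ_g·𝔡^{≤1}A̲ +
r⁻¹𝔡^{≤1}Ξ·A̲` is `O(·)`-sorting).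
[cite: GiorgiKlainermanSzeftel2024, p0933 L132–153, (5.3.2) p0199 L45–49; GiorgiKlainermanSzeftel2022, l.37756–37761, l.9097–9099] -/
theorem D10_LHS_Q [CharZero K] {D4 : Derivation ℤ K K} (T4 : CovD D4 M₂) (i trch atrch x : K)
    (A QA : M₂) (hi : i ^ 2 = -1) (hx : x = trch - i * atrch)
    (hQ : QA = T4.op (T4.op A) + C1 i trch atrch • T4.op A + C2 i trch atrch • A) :
    T4.op (T4.op A) + (2 * x) • T4.op A + (1 / 2 * (x * x)) • A
      = QA + (2 * (atrch ^ 2 / trch) + 2 * i * atrch) • T4.op A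
        + (-(3 / 2) * (atrch ^ 4 / trch ^ 2) + 7 / 2 * atrch ^ 2 + i * trch * atrch
          - 4 * i * (atrch ^ 3 / trch)) • A := by
  obtain ⟨h1, h2⟩ := D10_coeff i trch atrch hi
  rw [← h1, ← h2, hQ, hx]
  module

/-- `𝔮̲ = q̄q³(ᶜ∇₄ᶜ∇₄A̲ + C̲₁ᶜ∇₄A̲ + C̲₂A̲)` ((5.3.2), Definition 5.3.1) is the sibling's `qfrak T4 w
C̲₁ C̲₂ A̲` with `w = q̄q³`, i.e. `w·Q̲(A̲)`.
[cite: GiorgiKlainermanSzeftel2024, (5.3.2) p0199 L45–49; GiorgiKlainermanSzeftel2022, l.9097–9099] -/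
theorem D10_qfrak {D4 : Derivation ℤ K K} (T4 : CovD D4 M₂) (i trch atrch w : K) (A QA : M₂)
    (hQ : QA = T4.op (T4.op A) + C1 i trch atrch • T4.op A + C2 i trch atrch • A) :
    qfrak T4 w (C1 i trch atrch) (C2 i trch atrch) A = w • QA := by
  unfold qfrak
  rw [hQ]

/-- "Writing `∇₄A̲ = A̲₄ − ½tr XA̲`" (`hA4`: `A̲₄ = ᶜ∇₄A̲ + ½tr XA̲`, §5.3.1 p0198 L16–20, Definition
2.4.16), "we have `LHS = Q̲(A̲) + (2ªtr χ²/tr χ + 2iªtr χ)(A̲₄ − ½(tr χ − iªtr χ)A̲) + (…)A̲ + … =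
Q̲(A̲) + (2ªtr χ²/tr χ + 2iªtr χ)A̲₄ + (−(3/2)ªtr χ⁴/tr χ² + (3/2)ªtr χ² − 3iªtr χ³/tr χ)A̲ +
r⁻¹𝔡^{≤1}Ξ·A̲ = Q̲(A̲) + O(ar⁻²)A̲₄ + O(a²r⁻⁴)A̲ + r⁻¹𝔡^{≤1}Ξ·A̲`" (the `A̲`-coefficient: `−(2ªtr χ²/tr χ
+ 2iªtr χ)·½(tr χ − iªtr χ) = −ªtr χ² + iªtr χ³/tr χ − i tr χªtr χ + i²ªtr χ²`, with `i² = −1` and `tr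
χ ≠ 0`; the last line is `O(·)`-sorting).
[cite: GiorgiKlainermanSzeftel2024, p0934 L5–53, p0198 L16–20; GiorgiKlainermanSzeftel2022, l.37763–37770, l.9036–9040] -/
theorem D10_LHS_A4 [CharZero K] {D4 : Derivation ℤ K K} (T4 : CovD D4 M₂) (i trch atrch x : K)
    (A A4 QA : M₂) (hi : i ^ 2 = -1) (htrch : trch ≠ 0) (hx : x = trch - i * atrch)
    (hA4 : A4 = T4.op A + (1 / 2 * x) • A) :
    QA + (2 * (atrch ^ 2 / trch) + 2 * i * atrch) • T4.op A
        + (-(3 / 2) * (atrch ^ 4 / trch ^ 2) + 7 / 2 * atrch ^ 2 + i * trch * atrch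
          - 4 * i * (atrch ^ 3 / trch)) • A
      = QA + (2 * (atrch ^ 2 / trch) + 2 * i * atrch) • A4
        + (-(3 / 2) * (atrch ^ 4 / trch ^ 2) + 3 / 2 * atrch ^ 2
          - 3 * i * (atrch ^ 3 / trch)) • A := by
  have hT : T4.op A = A4 - (1 / 2 * x) • A := by rw [hA4]; module
  have hc : -((2 * (atrch ^ 2 / trch) + 2 * i * atrch) * (1 / 2 * x))
      + (-(3 / 2) * (atrch ^ 4 / trch ^ 2) + 7 / 2 * atrch ^ 2 + i * trch * atrch
          - 4 * i * (atrch ^ 3 / trch))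
      = -(3 / 2) * (atrch ^ 4 / trch ^ 2) + 3 / 2 * atrch ^ 2 - 3 * i * (atrch ^ 3 / trch) := by
    have hinv : trch⁻¹ * trch = 1 := inv_mul_cancel₀ htrch
    subst hx
    linear_combination (atrch ^ 2) * hi - (atrch ^ 2) * hinv
  rw [hT, smul_sub, smul_smul, ← hc]
  module

/-! ## §8 "Consider now the RHS of (D.10.1)" -/

/-- "Using (D.5.6), i.e. `ᶜ𝒟P = −3PH̲ + ᶜ𝒟P̌ + r⁻³Γ_g`" (`h56`: `DPc = ᶜ𝒟P̌`, `E7` the last term)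
on the right-hand side of (D.10.1), with the Leibniz rule of Lemma 2.4.6 for `ᶜ𝒟̂⊗(3PH̲)` (`hL2`):
"we obtain `RHS = ½ᶜ𝒟̂⊗(−3PH̲ + 𝒟P̌) + (4(−3PH̲ + 𝒟P̌) + 6PH̲ + tr XB̲)⊗̂H̲ + (3/2)P(tr X X̲̂ + conj(tr
X̲)X̂) + r⁻⁴𝔡̸^{≤1}Γ_g + … = ½ᶜ𝒟̂⊗𝒟P̌ − (3/2)𝒟P⊗̂H̲ − (3/2)P𝒟̂⊗H̲ + (4𝒟P̌ − 6PH̲ + tr XB̲)⊗̂H̲ +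
(3/2)P(tr X X̲̂ + conj(tr X̲)X̂) + r⁻⁴𝔡̸^{≤1}Γ_g + …`" (the text files the `r⁻³Γ_g` of (D.5.6) under
`r⁻⁴𝔡̸^{≤1}Γ_g`; the kernel carries it exactly: `½ᶜ𝒟̂⊗E7 + 4E7⊗̂H̲`).
[cite: GiorgiKlainermanSzeftel2024, p0934 L57–95, (D.5.6) p0869 L5–15, Lemma 2.4.6 p0112 L16–29; GiorgiKlainermanSzeftel2022, l.37781–37789, l.35475–35483] -/
theorem D10_RHS_D56 [CharZero K] (hot : M₁ →ₗ[K] M₁ →ₗ[K] M₂) (Dhot : M₁ →+ M₂) (x xbc p : K)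
    (Bu Hu DP DPc E7 : M₁) (Xbh Xh R' : M₂)
    (h56 : DP = -((3 * p) • Hu) + DPc + E7)
    (hL2 : Dhot ((3 * p) • Hu) = (3 * p) • Dhot Hu + (3 : K) • hot DP Hu) :
    (1 / 2 : K) • Dhot DP + hot ((4 : K) • DP + (6 * p) • Hu + x • Bu) Hu
        + (3 / 2 * p) • (x • Xbh + xbc • Xh) + R'
      = (1 / 2 : K) • Dhot DPc - (3 / 2 : K) • hot DP Hu - (3 / 2 * p) • Dhot Hu
        + hot ((4 : K) • DPc - (6 * p) • Hu + x • Bu) Hu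
        + (3 / 2 * p) • (x • Xbh + xbc • Xh) + (R' + (1 / 2 : K) • Dhot E7 + (4 : K) • hot E7 Hu) := by
  conv_lhs => rw [h56]
  simp only [map_add, map_neg, map_sub, map_smul, LinearMap.add_apply, LinearMap.sub_apply,
    LinearMap.smul_apply, LinearMap.neg_apply, hL2]
  module

/-- "Using, see (4.1.13), that `𝒟̂⊗H̲ = −H̲⊗̂H̲ + r⁻¹𝔡^{≤1}Γ_g`" (`hE3`: `E3` the element of (4.1.13))
and (D.5.6) once more for the `−(3/2)𝒟P⊗̂H̲` (`h56`), "we obtain `RHS = ½ᶜ𝒟̂⊗𝒟P̌ − (3/2)(−3PH̲ +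
𝒟P̌)⊗̂H̲ − (3/2)P(−H̲⊗̂H̲) + (4𝒟P̌ − 6PH̲ + tr XB̲)⊗̂H̲ + (3/2)P(tr X X̲̂ + conj(tr X̲)X̂) + r⁻¹𝔡^{≤1}Γ_g·P̌
+ r⁻⁴𝔡̸^{≤1}Γ_g + … = ½ᶜ𝒟̂⊗𝒟P̌ + (5/2)(𝒟P̌)⊗̂H̲ + tr X B̲⊗̂H̲ + (3/2)P(tr X X̲̂ + conj(tr X̲)X̂) +
r⁻¹𝔡^{≤1}Γ_g·P̌ + r⁻⁴𝔡̸^{≤1}Γ_g + Ξ⊗̂∇₃B̲ + r⁻¹𝔡^{≤1}(Ξ·A̲) + r⁻¹𝔡^{≤1}(Γ_g·B̲) + r⁻¹𝔡^{≤1}(Γ_b·B)`"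
— the `PH̲⊗̂H̲` terms cancel (`9/2 + 3/2 − 6 = 0`), the `𝒟P̌⊗̂H̲` terms give `−3/2 + 4 = 5/2`; the
remainder exactly `R' + ½ᶜ𝒟̂⊗E7 + 4E7⊗̂H̲ − (3/2)E7⊗̂H̲ − (3/2)P·E3` ("The above can be further
simplified, and we obtain …", p0935 L5–13, is `O(·)`-sorting).
[cite: GiorgiKlainermanSzeftel2024, p0934 L96 – p0935 L13, (4.1.13) p0159 L72–89; GiorgiKlainermanSzeftel2022, l.37790–37803, l.7250–7260] -/
theorem D10_RHS_final [CharZero K] (hot : M₁ →ₗ[K] M₁ →ₗ[K] M₂) (Dhot : M₁ →+ M₂) (x xbc p : K)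
    (Bu Hu DP DPc E7 : M₁) (Xbh Xh R' E3 : M₂)
    (h56 : DP = -((3 * p) • Hu) + DPc + E7) (hE3 : Dhot Hu + hot Hu Hu = E3) :
    (1 / 2 : K) • Dhot DPc - (3 / 2 : K) • hot DP Hu - (3 / 2 * p) • Dhot Hu
        + hot ((4 : K) • DPc - (6 * p) • Hu + x • Bu) Hu
        + (3 / 2 * p) • (x • Xbh + xbc • Xh) + (R' + (1 / 2 : K) • Dhot E7 + (4 : K) • hot E7 Hu)
      = (1 / 2 : K) • Dhot DPc + (5 / 2 : K) • hot DPc Hu + x • hot Bu Hu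
        + (3 / 2 * p) • (x • Xbh + xbc • Xh)
        + (R' + (1 / 2 : K) • Dhot E7 + (4 : K) • hot E7 Hu - (3 / 2 : K) • hot E7 Hu
          - (3 / 2 * p) • E3) := by
  rw [h56, eq_sub_of_add_eq hE3]
  simp only [map_add, map_neg, map_sub, map_smul, LinearMap.add_apply, LinearMap.sub_apply,
    LinearMap.smul_apply, LinearMap.neg_apply]
  module

/-! ## §9 "By combining the above with the LHS, we obtain" — the exact identity -/

/-- Proposition 5.6.1 in exact form, composed from the primitive hypotheses of §§1–8 (all named as
there): "By combining the above with the LHS, we obtain `Q̲(A̲) = ½ᶜ𝒟̂⊗𝒟P̌ +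
r⁻⁴𝔡̸^{≤1}(Γ_b, rΓ_g) + O(ar⁻²)A̲₄ + O(ar⁻⁴)A̲ + O(ar⁻³)𝔡^{≤1}P̌ + r⁻¹𝔡^{≤1}(Γ_b·(P̌, B)) +
r⁻²𝔡^{≤1}(Γ_g·(rB̲, A̲)) + Ξ⊗̂∇₃B̲ + r⁻¹𝔡^{≤1}(Ξ·A̲)` as stated" — exactly:
`Q̲(A̲) = ½ᶜ𝒟̂⊗ᶜ𝒟P̌ + (5/2)ᶜ𝒟P̌⊗̂H̲ + tr X B̲⊗̂H̲ + (3/2)P(tr X X̲̂ + conj(tr X̲)X̂) − (2ªtr χ²/tr χ +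
2iªtr χ)A̲₄ − (−(3/2)ªtr χ⁴/tr χ² + (3/2)ªtr χ² − 3iªtr χ³/tr χ)A̲ − ½(ᶜ∇₄tr X + ½(tr X)²)A̲ −
½Ξ⊗̂ᶜ∇₃B̲ − ½E1 − ½ᶜ𝒟̂⊗(Γ_b·B + Ξ·A̲) − (5/2)H̲⊗̂(Γ_b·B + Ξ·A̲) − 3(½ᶜ𝒟·B̄ + H̲·B̄ + Ξ·B̲ +
Γ_b·A)X̲̂ − (3/4)PΞ⊗̂Ξ̲ + (½E5 − 2E4)⊗̂B̲ + ½ᶜ𝒟̂⊗E7 + (5/2)E7⊗̂H̲ − (3/2)P·E3` — the principal part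
`½ᶜ𝒟̂⊗ᶜ𝒟P̌` being that of (5.6.1)/(5.6.2) and of Lemma 14.1.7 (p0634 L25–43), the `A̲₄`-coefficient the
text's `O(ar⁻²)`, the `A̲`-coefficient its `O(ar⁻⁴)`.  The `O(·)`-classes, and the form "or …" (p0935
L25–35) behind (5.6.2), are the text's (module docstring, NOT CLAIMED).
[cite: GiorgiKlainermanSzeftel2024, p0935 L15–35, Proposition 5.6.1 p0208 L11–52, Lemma 14.1.7 p0634 L22–43; GiorgiKlainermanSzeftel2022, l.37805–37815, l.9499–9519, l.26236–26250] -/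
theorem D10_prop561_exact [CharZero K] {D4 : Derivation ℤ K K} (N4 : CovD D4 M₁)
    (T4 : CovD D4 M₂) (hot : M₁ →ₗ[K] M₁ →ₗ[K] M₂) (Dhot : M₁ →+ M₂)
    (i trch atrch x xbc p s divBc HBc XiBb GbA e6 : K)
    (Bu Hu Xi Xib DP DPc Dx GbB XiA N3B E4 E5 E7 : M₁) (A Xbh Xh comm E1 E3 A4 QA : M₂)
    (hi : i ^ 2 = -1) (htrch : trch ≠ 0) (hx : x = trch - i * atrch)
    (hsym : ∀ F G : M₁, hot F G = hot G F)
    (hBA : T4.op A + (1 / 2 * x) • A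
      = -((1 / 2 : K) • Dhot Bu) - (2 : K) • hot Hu Bu - (3 * p) • Xbh)
    (hcomm : comm = T4.op (Dhot Bu) - Dhot (N4.op Bu))
    (hd4HB : T4.op (hot Hu Bu) = hot Hu (N4.op Bu) + hot (N4.op Hu) Bu)
    (hC : comm = -((1 / 2 * x) • (Dhot Bu + (1 - s) • hot Hu Bu)) + hot Hu (N4.op Bu)
      + hot Xi N3B + E1)
    (hs : s = -1)
    (hB : N4.op Bu + DP = -(x • Bu) - (3 * p) • Hu + GbB + XiA)
    (hP : D4 p - 1 / 2 * divBc = -(3 / 2) * x * p + HBc + XiBb + GbA)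
    (hX : T4.op Xbh + (1 / 2 * x) • Xbh
      = (1 / 2 : K) • Dhot Hu + (1 / 2 : K) • hot Hu Hu - (1 / 2 * xbc) • Xh
        + (1 / 4 : K) • hot Xi Xib)
    (hL1 : Dhot (x • Bu) = x • Dhot Bu + hot Dx Bu)
    (hL2 : Dhot ((3 * p) • Hu) = (3 * p) • Dhot Hu + (3 : K) • hot DP Hu)
    (hE4 : N4.op Hu + x • Hu = E4) (hE5 : Dx + (2 * x) • Hu = E5)
    (hE3 : Dhot Hu + hot Hu Hu = E3)
    (hx4 : D4 x + 1 / 2 * (x * x) = e6)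
    (hQ : QA = T4.op (T4.op A) + C1 i trch atrch • T4.op A + C2 i trch atrch • A)
    (hA4 : A4 = T4.op A + (1 / 2 * x) • A)
    (h56 : DP = -((3 * p) • Hu) + DPc + E7) :
    QA = (1 / 2 : K) • Dhot DPc + (5 / 2 : K) • hot DPc Hu + x • hot Bu Hu
        + (3 / 2 * p) • (x • Xbh + xbc • Xh)
        - (2 * (atrch ^ 2 / trch) + 2 * i * atrch) • A4
        - (-(3 / 2) * (atrch ^ 4 / trch ^ 2) + 3 / 2 * atrch ^ 2 - 3 * i * (atrch ^ 3 / trch)) • A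
        - (1 / 2 * e6) • A
        + (-((1 / 2 : K) • hot Xi N3B) - (1 / 2 : K) • E1 - (1 / 2 : K) • Dhot (GbB + XiA)
          - (5 / 2 : K) • hot Hu (GbB + XiA) - (3 * (1 / 2 * divBc + HBc + XiBb + GbA)) • Xbh
          - (3 / 4 * p) • hot Xi Xib
          + hot ((1 / 2 : K) • E5 - (2 : K) • E4) Bu
          + (1 / 2 : K) • Dhot E7 + (5 / 2 : K) • hot E7 Hu - (3 / 2 * p) • E3) := by
  -- the remainder of "we deduce"
  obtain ⟨R, hR⟩ : ∃ R : M₂, R = -((1 / 2 : K) • hot Xi N3B) - (1 / 2 : K) • E1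
      - (1 / 2 : K) • Dhot (GbB + XiA) - (5 / 2 : K) • hot Hu (GbB + XiA)
      - (3 * (1 / 2 * divBc + HBc + XiBb + GbA)) • Xbh - (3 / 4 * p) • hot Xi Xib := ⟨_, rfl⟩
  -- §§1–6: (D.10.1)
  have h1 := D10_infer N4 T4 hot Dhot x p Bu Hu A Xbh comm hBA hcomm hd4HB
  have h2 := D10_have N4 T4 hot Dhot x p s Bu Hu Xi N3B A Xbh comm E1 h1 hC hs
  have h3 := D10_deduce N4 T4 hot Dhot x xbc p divBc HBc XiBb GbA Bu Hu Xi Xib DP GbB XiA N3B A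
    Xbh Xh E1 R h2 hB hP hX hR
  have h4 := D10_gives N4 T4 hot Dhot x xbc p Bu Hu DP Dx A Xbh Xh R h3 hL1 hL2 hsym
  have h5 := D10_using_BA N4 T4 hot Dhot x xbc p Bu Hu DP Dx A Xbh Xh R h4 hBA
  have h6 := D10_1 N4 T4 hot Dhot x xbc p Bu Hu DP Dx E4 E5 A Xbh Xh R h5
    (D10_vanishing_term N4 x Hu Dx E4 E5 hE4 hE5) hsym
  -- §7: the left-hand side
  have h7 := D10_LHS T4 x e6 A hx4
  have h8 := D10_LHS_Q T4 i trch atrch x A QA hi hx hQ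
  have h9 := D10_LHS_A4 T4 i trch atrch x A A4 QA hi htrch hx hA4
  -- §8: the right-hand side
  have h10 := D10_RHS_D56 hot Dhot x xbc p Bu Hu DP DPc E7 Xbh Xh
    (R + hot ((1 / 2 : K) • E5 - (2 : K) • E4) Bu) h56 hL2
  have h11 := D10_RHS_final hot Dhot x xbc p Bu Hu DP DPc E7 Xbh Xh
    (R + hot ((1 / 2 : K) • E5 - (2 : K) • E4) Bu) E3 h56 hE3
  subst hR
  linear_combination (norm := module) h6 - h7 - h8 - h9 + h10 + h11

end AppD10

end Literature.Geometry.Lorentzian.GiorgiKlainermanSzeftel2022.QfbPRelationLedger
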